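import Summits.QuantumFields.YangMills.Theorems.FluctuationComparisonRegPrIntLS2BetaRelativeMainTermBkg
import Summits.QuantumFields.YangMills.Theorems.FluctuationComparisonRegPrIntLS2BetaArcLinearCauchy
import Summits.QuantumFields.YangMills.Theorems.FluctuationComparisonRegPrIntLS2BetaFieldPackage
import HarnessLib

/-!
# S2β · letter (D♮)∕(D-stage) REL-TEL, the (C)-half — ★★★ THE RELATIVE (C)-STEP, ARC-LINEAR AND BACKGROUND-PRICED (self-audit FINDING 14:09Z on ✓p824595):
# `dist1 (Ū₀(∂Q)⁻¹·Ū(∂Q)) ≤ (1 + 26·((d+2)L)²θ)·Σ_p K Q p·δ_p + 7·10⁵·((d+2)L)²θ₀·(β_W + β_A) + 2.8·10⁶·β_W² + 7·10⁶·β_W·β_A + 1.4·10⁷·((d+2)L)²θ₀·β_A² + 5·L³θ₀·γ`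
# — `β_W` = relative member LOOPS (closed: δ-type + BKG × arc by Stokes), `β_A` = relative axial ∕ staircase TRANSPORTS (open: pure arc); NO bare `β_A²`, so in
# px12 g24's (H♭♭) the off-diagonal weights carry BKG only.  Cell `ym3-torus` (rung R3 — NOT d = 4, NOT infinite volume, NOT a mass gap, NOT Clay); width seat «width 10»
# `ym3-torus-px10` (gen 23), FREE px helper on crux `stmt-QuantumFields-20520`, count-neutral, DEFINITION-FREE (UV3-NODE §82).
The arc-linear edition of ✓p824595 `relOneLevelStep_bkg` (same skeleton): the local datum is split into `β_W` (`hW`: four bonds' relative `loopHol`) and `β_A` (`hA`: relative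
`axialAvg`; `hS`: relative staircase `holAt`); the Cauchy letters are the ARC-LINEAR ones of ✓∕⧗`…ArcLinearCauchy` (`J(0, H) ≡ 0` ⟹ the context difference `4β_A` is paid
with the BACKGROUND's member-log size `2τ₀`): members `δ(W_m) ≤ β_W + 8τ₀β_A =: β_m`, log differences `≤ 2β_m`, radius `ρ := 2τ₀ + 2β_m + 4β_A`; main term ✓p824102.
HONEST SCOPE.  A composition of landed letters with admissible constants; nothing of Bałaban's renormalisation analysis asserted; the BKG-TOWER letter, the suppliers of
`β_W`∕`β_A`, the arc-linear `hstep`∕`hj` and torus editions, (H♭♭), (D-stage), GAP♯∘ (`stub_uniformFibreGapOrbit`), S2β, crux 20520 and `YM3TorusSU2` are NOT proved;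
no registered stub is closed; the Yang–Mills mass gap is NOT proved.  Sorry-free, axioms standard.
References: T. Bałaban, CMP **109** (1987) 249–301 [Balaban1987RG1] ((0.4)–(0.8) p.253, §3 p.273); CMP **98** (1985) 17–51 [Balaban1985Averaging] ((19), (21) p.21);
CMP **102** (1985) 277–309 [Balaban1985Variational] (Thm 1 (9)–(10) p.279).
-/

set_option autoImplicit false

noncomputable section

namespace Summit.QuantumFields.YangMills.Theorems.FluctuationComparisonRegPrIntLS2BetaRelativeOneLevelStepArc

open NormedSpace Finset
open scoped BigOperators Matrix.Norms.L2Operator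
open Literature.MathematicalPhysics.QuantumFieldTheory.Balaban1983to89
open Literature.MathematicalPhysics.QuantumFieldTheory.Balaban1983to89.T4Continuum
open Literature.MathematicalPhysics.QuantumFieldTheory.Balaban1983to89.AveragingRT
open Literature.MathematicalPhysics.QuantumFieldTheory.Balaban1983to89.BlockAveraging
open Literature.MathematicalPhysics.QuantumFieldTheory.Balaban1983to89.MatrixLog (mlog exp_mlog norm_mlog_le_two_mul)
open Literature.MathematicalPhysics.QuantumFieldTheory.Balaban1983to89.ExpMeanLog (expMeanLogSU deltaSU)
open Literature.MathematicalPhysics.QuantumFieldTheory.Balaban1983to89.LatticeWordStokes (dist1_loopHol_le small_of_plaqSmall)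
open Literature.MathematicalPhysics.QuantumFieldTheory.Balaban1983to89.T4TiltOscillation (bdev)
open B10Eq47AxialChi (shiftN rect plaqSmall_axialAvg)
open Summit.QuantumFields.YangMills.Theorems.FluctuationComparisonRegPrIntLS2BetaOneLevelStepLetters (coe_avg_eq_exp_mean norm_mean_le_mean memberWord_eq_conj_rect sq_L_le_quarter)
open Summit.QuantumFields.YangMills.Theorems.FluctuationComparisonRegPrIntLS2BetaRelativeStokes (dist1_rel_comm dist1_rel_mul_le dist1_rel_inv dist1_comm_le_SU)
open Summit.QuantumFields.YangMills.Theorems.FluctuationComparisonRegPrIntLS2BetaRelativeMemberLetters (norm_coe_sub_coe_eq_dist1_rel norm_mlog_sub_mlog_le_two_mul_dist1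
  dist1_rel_le_mul_norm_mlog_sub dist1_rel_conj_le' dist1_rel_conj_inv_le dist1_rel_prod3_le dist1_rel_prod4_le mean_norm_mlog_conjRect_sub_le)
open Summit.QuantumFields.YangMills.Theorems.FluctuationComparisonRegPrIntLS2BetaArcLinearCauchy (norm_hybrid4_sub_hybrid4_le_arcLinear norm_chain4_sub_chain4_le_arcLinear)
open Summit.QuantumFields.YangMills.Theorems.FluctuationComparisonRegPrIntLS2BetaFieldPackage (field_package)
open Summit.QuantumFields.YangMills.Theorems.FluctuationComparisonRegPrIntLS2BetaRelativeMainTermBkg (mean_norm_mlog_conjRect_sub_le_bkg)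

variable {n : Type*} [Fintype n] [DecidableEq n] [Nonempty n]
variable {P : Params} {j : ℕ}

/-! ## The arc-linear, background-priced relative (C)-step -/

set_option maxHeartbeats 400000 in
/-- ★★★ **THE RELATIVE (C)-STEP, ARC-LINEAR AND BACKGROUND-PRICED** (`SU(N)`, `expMeanLogSU`, standing range; `PlaqSmall θ U` with `((d+2)L)²θ ≤ 1∕800`,
`PlaqSmall θ₀ U₀` with `0 ≤ θ₀ ≤ θ`, guard `((d+2)L)²∕4·θ < δ_N`; local relative data: member LOOPS `≤ β_W`, axial ∕ staircase TRANSPORTS `≤ β_A`, both `≤ 1∕12800`;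
forward-near bond deviations `≤ γ`):
`dist1 (Ū₀(∂Q)⁻¹·Ū(∂Q)) ≤ (1 + 26·((d+2)L)²θ)·Σ_p K Q p·δ_p + 700000·((d+2)L)²θ₀·(β_W + β_A) + 2800000·β_W² + 7000000·β_W·β_A + 14000000·((d+2)L)²θ₀·β_A² + 5·L³θ₀·γ`
— no bare `β_A²`. [cite: Balaban1987RG1, (0.4)-(0.8) p.253] -/
theorem relOneLevelStep_arc (hj : j + 1 ≤ P.m + P.K) (U U₀ : GaugeField P j (Matrix.specialUnitaryGroup n ℂ)) {θ θ₀ : ℝ} (hθ00 : 0 ≤ θ₀) (hθ₀θ : θ₀ ≤ θ)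
    (hθ : (((P.d + 2) * P.L : ℕ) : ℝ) ^ 2 * θ ≤ 1 / 800) (hδ : (((P.d + 2) * P.L : ℕ) : ℝ) ^ 2 / 4 * θ < deltaSU n)
    (hU : PlaqSmall θ U) (hU₀ : PlaqSmall θ₀ U₀) (Q : Plaq P (j + 1)) {βW βA γ : ℝ} (hβW0 : 0 ≤ βW) (hβA0 : 0 ≤ βA) (hβWs : βW ≤ 1 / 12800)
    (hβAs : βA ≤ 1 / 12800)
    (hW : ∀ c : PBond P (j + 1), (c = ⟨Q.src, Q.μ⟩ ∨ c = ⟨Q.src.shift Q.μ, Q.ν⟩ ∨ c = ⟨Q.src.shift Q.ν, Q.μ⟩ ∨ c = ⟨Q.src, Q.ν⟩) →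
      ∀ i, dist1 ((loopHol U₀ c i)⁻¹ * loopHol U c i) ≤ βW)
    (hA : ∀ c : PBond P (j + 1), (c = ⟨Q.src, Q.μ⟩ ∨ c = ⟨Q.src.shift Q.μ, Q.ν⟩ ∨ c = ⟨Q.src.shift Q.ν, Q.μ⟩ ∨ c = ⟨Q.src, Q.ν⟩) →
      dist1 ((axialAvg U₀ c)⁻¹ * axialAvg U c) ≤ βA)
    (hS : ∀ i : Idx P, dist1 ((holAt U₀ (walk (emb Q.src) (stairWord i.2.1 (off i.1))))⁻¹ * holAt U (walk (emb Q.src) (stairWord i.2.1 (off i.1)))) ≤ βA)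
    (hdev : ∀ c : PBond P j, (∀ κ, blockOf c.src κ = Q.src κ ∨ blockOf c.src κ = Q.src κ + 1) → dist1 (bdev U U₀ c) ≤ γ) :
    dist1 ((GaugeField.plaqHol (avgFun (expMeanLogSU (n := n)) U₀) Q)⁻¹ * GaugeField.plaqHol (avgFun (expMeanLogSU (n := n)) U) Q) ≤
      (1 + 26 * ((((P.d + 2) * P.L : ℕ) : ℝ) ^ 2 * θ)) *
          ∑ p : Plaq P j, ((P.L : ℝ) ^ P.d)⁻¹ * (((block Q.src).filter (fun x : Site P j => p.μ = Q.μ ∧ p.ν = Q.ν ∧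
            ∃ a ∈ range P.L, ∃ b ∈ range P.L, p.src = shiftN (shiftN x Q.μ a) Q.ν b)).card : ℝ) *
            dist1 ((GaugeField.plaqHol U₀ p)⁻¹ * GaugeField.plaqHol U p) +
        700000 * ((((P.d + 2) * P.L : ℕ) : ℝ) ^ 2 * θ₀) * (βW + βA) + 2800000 * βW ^ 2 + 7000000 * βW * βA +
        14000000 * ((((P.d + 2) * P.L : ℕ) : ℝ) ^ 2 * θ₀) * βA ^ 2 + 5 * (P.L : ℝ) ^ 3 * θ₀ * γ := by
  -- ### the two packages (before the abbreviations, so that `set` rewrites them); the background's at ITS OWN size `θ₀`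
  have hθ0 : 0 ≤ θ := hθ00.trans hθ₀θ
  have hθ50 : (((P.d + 2) * P.L : ℕ) : ℝ) ^ 2 * θ ≤ 1 / 50 := hθ.trans (by norm_num)
  have hθ50₀ : (((P.d + 2) * P.L : ℕ) : ℝ) ^ 2 * θ₀ ≤ 1 / 50 := (mul_le_mul_of_nonneg_left hθ₀θ (by positivity)).trans hθ50
  have hδ₀ : (((P.d + 2) * P.L : ℕ) : ℝ) ^ 2 / 4 * θ₀ < deltaSU n := (mul_le_mul_of_nonneg_left hθ₀θ (by positivity)).trans_lt hδ
  obtain ⟨hgU, -, hplaqMU, hm50U, hplaqU⟩ := field_package hj U hθ0 hθ50 hδ hU Q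
  obtain ⟨hgU₀, hHnU₀, hplaqMU₀, hm50U₀', hplaqU₀⟩ := field_package hj U₀ hθ00 hθ50₀ hδ₀ hU₀ Q
  -- ### thresholds: `τ` (history, field) and `τ₀ ≤ τ` (background)
  set cc : ℝ := (((P.d + 2) * P.L : ℕ) : ℝ) ^ 2 / 4 with hcc
  set τ : ℝ := cc * θ with hτdef
  set τ₀ : ℝ := cc * θ₀ with hτ₀def
  have hcc0 : 0 ≤ cc := by positivity
  have hτ0 : 0 ≤ τ := mul_nonneg hcc0 hθ0
  have hτ₀0 : 0 ≤ τ₀ := mul_nonneg hcc0 hθ00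
  have hτ₀τ : τ₀ ≤ τ := mul_le_mul_of_nonneg_left hθ₀θ hcc0
  have hτs : τ ≤ 1 / 3200 := by rw [hτdef, hcc]; linarith only [hθ]
  have hτ₀s : τ₀ ≤ 1 / 3200 := hτ₀τ.trans hτs
  have h4τ : (((P.d + 2) * P.L : ℕ) : ℝ) ^ 2 * θ = 4 * τ := by rw [hτdef, hcc]; ring
  have h4τ₀ : (((P.d + 2) * P.L : ℕ) : ℝ) ^ 2 * θ₀ = 4 * τ₀ := by rw [hτ₀def, hcc]; ring
  have hL2 : (P.L : ℝ) ^ 2 * θ ≤ τ := by rw [hτdef]; exact mul_le_mul_of_nonneg_right (sq_L_le_quarter P) hθ0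
  have hL2₀ : (P.L : ℝ) ^ 2 * θ₀ ≤ τ₀ := by rw [hτ₀def]; exact mul_le_mul_of_nonneg_right (sq_L_le_quarter P) hθ00
  -- `θ₀ > 0`: a plaquette exists and `0 ≤ dist1 < θ₀`
  have hθ₀pos : 0 < θ₀ := lt_of_le_of_lt (GaugeGroup.dist1_nonneg _) (hU₀ ⟨emb Q.src, Q.μ, Q.ν, Q.hμν⟩)
  have hτ₀pos : 0 < τ₀ := by
    rw [hτ₀def, hcc]
    have : (0 : ℝ) < (((P.d + 2) * P.L : ℕ) : ℝ) ^ 2 / 4 := by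
      have hpos : (0 : ℝ) < (((P.d + 2) * P.L : ℕ) : ℝ) := by
        have : 0 < (P.d + 2) * P.L := Nat.mul_pos (by omega) P.L_pos
        exact_mod_cast this
      positivity
    exact mul_pos this hθ₀pos
  -- ### abbreviations
  set ℰ : LoopAverage (Matrix.specialUnitaryGroup n ℂ) := expMeanLogSU (n := n) with hℰ
  set c₁ : PBond P (j + 1) := ⟨Q.src, Q.μ⟩ with hc₁
  set c₂ : PBond P (j + 1) := ⟨Q.src.shift Q.μ, Q.ν⟩ with hc₂
  set c₃ : PBond P (j + 1) := ⟨Q.src.shift Q.ν, Q.μ⟩ with hc₃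
  set c₄ : PBond P (j + 1) := ⟨Q.src, Q.ν⟩ with hc₄
  set A₁ := axialAvg U c₁ with hA₁
  set A₂ := axialAvg U c₂ with hA₂
  set A₃ := axialAvg U c₃ with hA₃
  set A₄ := axialAvg U c₄ with hA₄
  set B₁ := axialAvg U₀ c₁ with hB₁
  set B₂ := axialAvg U₀ c₂ with hB₂
  set B₃ := axialAvg U₀ c₃ with hB₃
  set B₄ := axialAvg U₀ c₄ with hB₄
  set P₃ := A₁ * A₂ * A₃⁻¹ with hP₃
  set P₃' := B₁ * B₂ * B₃⁻¹ with hP₃'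
  set H₀ := A₁ * A₂ * A₃⁻¹ * A₄⁻¹ with hH₀
  set H₀' := B₁ * B₂ * B₃⁻¹ * B₄⁻¹ with hH₀'
  set W₁ : Idx P → Matrix.specialUnitaryGroup n ℂ := fun i => loopHol U c₁ i with hW₁
  set W₂ : Idx P → Matrix.specialUnitaryGroup n ℂ := fun i => A₁ * loopHol U c₂ i * A₁⁻¹ with hW₂
  set W₃ : Idx P → Matrix.specialUnitaryGroup n ℂ := fun i => P₃ * (loopHol U c₃ i)⁻¹ * P₃⁻¹ with hW₃
  set W₄ : Idx P → Matrix.specialUnitaryGroup n ℂ := fun i => H₀ * (loopHol U c₄ i)⁻¹ * H₀⁻¹ with hW₄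
  set V₁ : Idx P → Matrix.specialUnitaryGroup n ℂ := fun i => loopHol U₀ c₁ i with hV₁
  set V₂ : Idx P → Matrix.specialUnitaryGroup n ℂ := fun i => B₁ * loopHol U₀ c₂ i * B₁⁻¹ with hV₂
  set V₃ : Idx P → Matrix.specialUnitaryGroup n ℂ := fun i => P₃' * (loopHol U₀ c₃ i)⁻¹ * P₃'⁻¹ with hV₃
  set V₄ : Idx P → Matrix.specialUnitaryGroup n ℂ := fun i => H₀' * (loopHol U₀ c₄ i)⁻¹ * H₀'⁻¹ with hV₄
  set a₁ : Idx P → Matrix n n ℂ := fun i => mlog (W₁ i : Matrix n n ℂ) with ha₁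
  set a₂ : Idx P → Matrix n n ℂ := fun i => mlog (W₂ i : Matrix n n ℂ) with ha₂
  set a₃ : Idx P → Matrix n n ℂ := fun i => mlog (W₃ i : Matrix n n ℂ) with ha₃
  set a₄ : Idx P → Matrix n n ℂ := fun i => mlog (W₄ i : Matrix n n ℂ) with ha₄
  set b₁ : Idx P → Matrix n n ℂ := fun i => mlog (V₁ i : Matrix n n ℂ) with hb₁
  set b₂ : Idx P → Matrix n n ℂ := fun i => mlog (V₂ i : Matrix n n ℂ) with hb₂
  set b₃ : Idx P → Matrix n n ℂ := fun i => mlog (V₃ i : Matrix n n ℂ) with hb₃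
  set b₄ : Idx P → Matrix n n ℂ := fun i => mlog (V₄ i : Matrix n n ℂ) with hb₄
  obtain ⟨hτh, hτ₀h⟩ : τ ≤ 1 / 2 ∧ τ₀ ≤ 1 / 2 := ⟨by linarith only [hτs], by linarith only [hτ₀s]⟩
  -- ### (1) sizes of members (field: `τ`; background: `τ₀`) and of the background's logarithms
  obtain ⟨hgW₁, hgW₂, hgW₃, hgW₄⟩ : (∀ i, dist1 (W₁ i) ≤ τ) ∧ (∀ i, dist1 (W₂ i) ≤ τ) ∧ (∀ i, dist1 (W₃ i) ≤ τ) ∧ (∀ i, dist1 (W₄ i) ≤ τ) :=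
    ⟨fun i => (hgU i).1, fun i => (hgU i).2.1, fun i => (hgU i).2.2.1, fun i => (hgU i).2.2.2⟩
  obtain ⟨hgV₁, hgV₂, hgV₃, hgV₄⟩ : (∀ i, dist1 (V₁ i) ≤ τ₀) ∧ (∀ i, dist1 (V₂ i) ≤ τ₀) ∧ (∀ i, dist1 (V₃ i) ≤ τ₀) ∧ (∀ i, dist1 (V₄ i) ≤ τ₀) :=
    ⟨fun i => (hgU₀ i).1, fun i => (hgU₀ i).2.1, fun i => (hgU₀ i).2.2.1, fun i => (hgU₀ i).2.2.2⟩
  have size : ∀ (W : Idx P → Matrix.specialUnitaryGroup n ℂ) (t : ℝ), t ≤ 1 / 2 → (∀ i, dist1 (W i) ≤ t) → ∀ i, ‖mlog (W i : Matrix n n ℂ)‖ ≤ 2 * t :=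
      fun W t ht hWτ i => by
    have h1 : ‖(W i : Matrix n n ℂ) - 1‖ ≤ 1 / 2 := (hWτ i).trans ht
    exact (norm_mlog_le_two_mul h1).trans (by have h2 : ‖(W i : Matrix n n ℂ) - 1‖ ≤ t := hWτ i; linarith only [h2])
  obtain ⟨hρb₁, hρb₂, hρb₃, hρb₄⟩ : (∀ i, ‖b₁ i‖ ≤ 2 * τ₀) ∧ (∀ i, ‖b₂ i‖ ≤ 2 * τ₀) ∧ (∀ i, ‖b₃ i‖ ≤ 2 * τ₀) ∧ (∀ i, ‖b₄ i‖ ≤ 2 * τ₀) :=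
    ⟨size V₁ τ₀ hτ₀h hgV₁, size V₂ τ₀ hτ₀h hgV₂, size V₃ τ₀ hτ₀h hgV₃, size V₄ τ₀ hτ₀h hgV₄⟩
  -- ### (2) relative members, READ FROM THE BACKGROUND SIDE: conjugation by relative transports costs BKG-SIZE × RELATIVE ARC
  have hℓ₀ : ∀ c i, dist1 (loopHol U₀ c i) ≤ τ₀ := fun c i => dist1_loopHol_le hθ00 hU₀ c i
  have hWc : ∀ c : PBond P (j + 1), (c = c₁ ∨ c = c₂ ∨ c = c₃ ∨ c = c₄) → ∀ i, dist1 ((loopHol U c i)⁻¹ * loopHol U₀ c i) ≤ βW :=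
    fun c hc i => by rw [dist1_rel_comm]; exact hW c hc i
  obtain ⟨hA₁, hA₂, hA₃, hA₄⟩ : dist1 (B₁⁻¹ * A₁) ≤ βA ∧ dist1 (B₂⁻¹ * A₂) ≤ βA ∧ dist1 (B₃⁻¹ * A₃) ≤ βA ∧ dist1 (B₄⁻¹ * A₄) ≤ βA :=
    ⟨hA c₁ (Or.inl rfl), hA c₂ (Or.inr (Or.inl rfl)), hA c₃ (Or.inr (Or.inr (Or.inl rfl))), hA c₄ (Or.inr (Or.inr (Or.inr rfl)))⟩
  have hP₃rel : dist1 (P₃'⁻¹ * P₃) ≤ 3 * βA := by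
    have h := dist1_rel_prod3_le A₁ A₂ A₃ B₁ B₂ B₃; linarith only [h, hA₁, hA₂, hA₃]
  have hH₀rel : dist1 (H₀'⁻¹ * H₀) ≤ 4 * βA := by
    have h := dist1_rel_prod4_le A₁ A₂ A₃ A₄ B₁ B₂ B₃ B₄; linarith only [h, hA₁, hA₂, hA₃, hA₄]
  have hA₁' : dist1 (A₁⁻¹ * B₁) ≤ βA := by rw [dist1_rel_comm]; exact hA₁
  have hP₃rel' : dist1 (P₃⁻¹ * P₃') ≤ 3 * βA := by rw [dist1_rel_comm]; exact hP₃rel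
  have hH₀rel' : dist1 (H₀⁻¹ * H₀') ≤ 4 * βA := by rw [dist1_rel_comm]; exact hH₀rel
  -- the common member bound `βm := β_W + 8τ₀β_A` (loop datum + BKG × arc)
  set βm : ℝ := βW + 8 * τ₀ * βA with hβmdef
  have hτβA0 : 0 ≤ τ₀ * βA := mul_nonneg hτ₀0 hβA0
  have hβm0 : 0 ≤ βm := by rw [hβmdef]; linarith only [hβW0, hτβA0]
  have hdW₁ : ∀ i, dist1 ((V₁ i)⁻¹ * W₁ i) ≤ βm := fun i => (hW c₁ (Or.inl rfl) i).trans (by rw [hβmdef]; linarith only [hτβA0])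
  have hdW₂ : ∀ i, dist1 ((V₂ i)⁻¹ * W₂ i) ≤ βm := fun i => by
    have h := dist1_rel_conj_le' dist1_comm_le_SU (hℓ₀ c₂ i) (hWc c₂ (Or.inr (Or.inl rfl)) i) hA₁' (ℓ₀ := loopHol U c₂ i) (T₀ := A₁)
    exact (le_of_eq (dist1_rel_comm _ _)).trans (h.trans (by rw [hβmdef]; linarith only [hτβA0]))
  have hdW₃ : ∀ i, dist1 ((V₃ i)⁻¹ * W₃ i) ≤ βm := fun i => by
    have h := dist1_rel_conj_inv_le dist1_comm_le_SU (hℓ₀ c₃ i) (hWc c₃ (Or.inr (Or.inr (Or.inl rfl))) i) hP₃rel' (ℓ₀ := loopHol U c₃ i) (T₀ := P₃)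
    exact (le_of_eq (dist1_rel_comm _ _)).trans (h.trans (by rw [hβmdef]; linarith only [hτβA0]))
  have hdW₄ : ∀ i, dist1 ((V₄ i)⁻¹ * W₄ i) ≤ βm := fun i => by
    have h := dist1_rel_conj_inv_le dist1_comm_le_SU (hℓ₀ c₄ i) (hWc c₄ (Or.inr (Or.inr (Or.inr rfl))) i) hH₀rel' (ℓ₀ := loopHol U c₄ i) (T₀ := H₀)
    exact (le_of_eq (dist1_rel_comm _ _)).trans (h.trans (by rw [hβmdef]; linarith only [hτβA0]))
  -- ### (3) relative logarithms `≤ 2βm` and the context `≤ 4β_A`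
  have logrel : ∀ (W V : Idx P → Matrix.specialUnitaryGroup n ℂ), (∀ i, dist1 (W i) ≤ τ) → (∀ i, dist1 (V i) ≤ τ₀) →
      (∀ i, dist1 ((V i)⁻¹ * W i) ≤ βm) → ∀ i, ‖mlog (W i : Matrix n n ℂ) - mlog (V i : Matrix n n ℂ)‖ ≤ 2 * βm := fun W V hWτ hVτ hd i =>
    (norm_mlog_sub_mlog_le_two_mul_dist1 (W i) (V i) ((hWτ i).trans hτh) ((hVτ i).trans hτ₀h)).trans (by linarith only [hd i])
  obtain ⟨hda₁, hda₂, hda₃, hda₄⟩ : (∀ i, ‖a₁ i - b₁ i‖ ≤ 2 * βm) ∧ (∀ i, ‖a₂ i - b₂ i‖ ≤ 2 * βm) ∧ (∀ i, ‖a₃ i - b₃ i‖ ≤ 2 * βm) ∧ (∀ i, ‖a₄ i - b₄ i‖ ≤ 2 * βm) :=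
    ⟨logrel W₁ V₁ hgW₁ hgV₁ hdW₁, logrel W₂ V₂ hgW₂ hgV₂ hdW₂, logrel W₃ V₃ hgW₃ hgV₃ hdW₃, logrel W₄ V₄ hgW₄ hgV₄ hdW₄⟩
  have hdH : ‖(H₀ : Matrix n n ℂ) - (H₀' : Matrix n n ℂ)‖ ≤ 4 * βA := by rw [norm_coe_sub_coe_eq_dist1_rel]; exact hH₀rel
  have hβm2 : 0 ≤ 2 * βm := by linarith only [hβm0]
  -- ### (4) the Cauchy radius `ρ := 2τ₀ + 2βm + 4β_A`; the field's logarithms and context sit in that ball BY THE RELATIVE BOUNDS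
  set ρ : ℝ := 2 * τ₀ + 2 * βm + 4 * βA with hρdef
  have hρ0 : 0 < ρ := by rw [hρdef]; linarith only [hτ₀pos, hβm0, hβA0]
  have hρ0' : 0 ≤ ρ := hρ0.le
  have hρs : ρ ≤ 1 / 800 := by rw [hρdef, hβmdef]; nlinarith only [hτ₀s, hτ₀0, hβWs, hβAs, hβA0]
  have inball : ∀ (a b : Idx P → Matrix n n ℂ), (∀ i, ‖b i‖ ≤ 2 * τ₀) → (∀ i, ‖a i - b i‖ ≤ 2 * βm) → ∀ i, ‖a i‖ ≤ ρ := fun a b hb hab i => by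
    have h : ‖a i‖ ≤ ‖b i‖ + ‖a i - b i‖ := by
      have h' := norm_add_le (b i) (a i - b i); rwa [show b i + (a i - b i) = a i by abel] at h'
    rw [hρdef]; linarith only [h, hb i, hab i, hβA0]
  obtain ⟨hρa₁, hρa₂, hρa₃, hρa₄⟩ : (∀ i, ‖a₁ i‖ ≤ ρ) ∧ (∀ i, ‖a₂ i‖ ≤ ρ) ∧ (∀ i, ‖a₃ i‖ ≤ ρ) ∧ (∀ i, ‖a₄ i‖ ≤ ρ) :=
    ⟨inball a₁ b₁ hρb₁ hda₁, inball a₂ b₂ hρb₂ hda₂, inball a₃ b₃ hρb₃ hda₃, inball a₄ b₄ hρb₄ hda₄⟩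
  have h2ρ : 2 * τ₀ ≤ ρ := by rw [hρdef]; linarith only [hβm0, hβA0]
  obtain ⟨hρb₁', hρb₂', hρb₃', hρb₄'⟩ : (∀ i, ‖b₁ i‖ ≤ ρ) ∧ (∀ i, ‖b₂ i‖ ≤ ρ) ∧ (∀ i, ‖b₃ i‖ ≤ ρ) ∧ (∀ i, ‖b₄ i‖ ≤ ρ) :=
    ⟨fun i => (hρb₁ i).trans h2ρ, fun i => (hρb₂ i).trans h2ρ, fun i => (hρb₃ i).trans h2ρ, fun i => (hρb₄ i).trans h2ρ⟩
  -- contexts: `‖H₀' − 1‖ ≤ e^{2τ₀} − 1 ≤ e^{ρ} − 1`; `‖H₀ − 1‖ ≤ ‖H₀ − H₀'‖ + ‖H₀' − 1‖ ≤ 4β_A + (e^{2τ₀} − 1) ≤ e^{ρ} − 1`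
  have hexy : Real.exp (2 * τ₀) - 1 + 4 * βA ≤ Real.exp ρ - 1 := by
    have hle : Real.exp (2 * τ₀ + 4 * βA) ≤ Real.exp ρ := Real.exp_le_exp.mpr (by rw [hρdef]; linarith only [hβm0])
    rw [Real.exp_add] at hle
    have h1 : 1 ≤ Real.exp (2 * τ₀) := Real.one_le_exp (by linarith only [hτ₀0])
    have h2 : 4 * βA + 1 ≤ Real.exp (4 * βA) := Real.add_one_le_exp _
    have h3 := mul_le_mul_of_nonneg_left h2 (zero_le_one.trans h1)
    nlinarith only [h1, h3, hβA0, hle]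
  have hHρ₀ : ‖(H₀' : Matrix n n ℂ) - 1‖ ≤ Real.exp ρ - 1 := hHnU₀.trans (by linarith only [hexy, hβA0])
  have hHρ : ‖(H₀ : Matrix n n ℂ) - 1‖ ≤ Real.exp ρ - 1 :=
    (norm_sub_le_norm_sub_add_norm_sub _ (H₀' : Matrix n n ℂ) _).trans (by linarith only [hdH, hHnU₀, hexy])
  -- the ARC-LINEAR Cauchy letters (✓`…ArcLinearCauchy`): member difference `2βm` at the radius, context difference `4β_A` at the BACKGROUND size `2τ₀`
  have h2τ₀ : 0 ≤ 2 * τ₀ := by linarith only [hτ₀0]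
  have hJ₁₀ := norm_hybrid4_sub_hybrid4_le_arcLinear b₁ b₂ b₃ b₄ a₁ a₂ a₃ a₄ (H₀' : Matrix n n ℂ) (H₀ : Matrix n n ℂ) hρ0 hρs
    hρb₁' hρb₂' hρb₃' hρb₄' hHρ₀ hρa₁ hρa₂ hρa₃ hρa₄ hHρ h2τ₀ hρb₁ hρb₂ hρb₃ hρb₄ hβm2 hda₁ hda₂ hda₃ hda₄ hdH
  set τp : Equiv.Perm (Idx P) := Equiv.prodCongr (Equiv.refl _) (Equiv.prodComm _ _) with hτpdef
  have hτp : ∀ i : Idx P, τp i = (i.1, i.2.2, i.2.1) := fun i => rfl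
  have hJ₁₄ := norm_chain4_sub_chain4_le_arcLinear b₁ b₂ b₃ b₄ a₁ a₂ a₃ a₄ (H₀' : Matrix n n ℂ) (H₀ : Matrix n n ℂ) τp 1 τp hρ0 hρs
    hρb₁' hρb₂' hρb₃' hρb₄' hHρ₀ hρa₁ hρa₂ hρa₃ hρa₄ hHρ h2τ₀ hρb₁ hρb₂ hρb₃ hρb₄ hβm2 hda₁ hda₂ hda₃ hda₄ hdH
  -- ### (5) the chain means are the means of the logarithms of the conjugated squares (✓`memberWord_eq_conj_rect`, for each field)
  have hexpW : ∀ (W : Idx P → Matrix.specialUnitaryGroup n ℂ) (t : ℝ), t ≤ 1 / 2 → (∀ i, dist1 (W i) ≤ t) →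
      ∀ i, exp (mlog (W i : Matrix n n ℂ)) = (W i : Matrix n n ℂ) :=
    fun W t ht hW i => exp_mlog ((show ‖(W i : Matrix n n ℂ) - 1‖ ≤ t from hW i).trans_lt (by linarith only [ht]))
  have hone : ∀ x : Idx P, (1 : Equiv.Perm (Idx P)) x = x := fun x => rfl
  have hττ : ∀ i : Idx P, τp (τp i) = i := fun i => rfl
  have hchainU : ∀ i : Idx P, mlog (exp (a₁ i) * exp (a₂ (τp i)) * exp (a₃ ((1 : Equiv.Perm (Idx P)) (τp i))) *
      exp (a₄ (τp ((1 : Equiv.Perm (Idx P)) (τp i)))) * (H₀ : Matrix n n ℂ)) =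
      mlog ((holAt U (walk (emb Q.src) (stairWord i.2.1 (off i.1))) * rect U (Site.blockSite Q.src i.1) Q.μ Q.ν P.L P.L *
        (holAt U (walk (emb Q.src) (stairWord i.2.1 (off i.1))))⁻¹ : Matrix.specialUnitaryGroup n ℂ) : Matrix n n ℂ) := fun i => by
    rw [hone, hττ, ha₁, ha₂, ha₃, ha₄]
    simp only
    rw [hexpW W₁ τ hτh hgW₁, hexpW W₂ τ hτh hgW₂, hexpW W₃ τ hτh hgW₃, hexpW W₄ τ hτh hgW₄, ← Submonoid.coe_mul, ← Submonoid.coe_mul,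
      ← Submonoid.coe_mul, ← Submonoid.coe_mul]
    have hw : W₁ i * W₂ (τp i) * W₃ (τp i) * W₄ i * H₀ =
        holAt U (walk (emb Q.src) (stairWord i.2.1 (off i.1))) * rect U (Site.blockSite Q.src i.1) Q.μ Q.ν P.L P.L *
          (holAt U (walk (emb Q.src) (stairWord i.2.1 (off i.1))))⁻¹ := by
      rw [hτp]; exact memberWord_eq_conj_rect hj U Q i
    rw [hw]
  have hchainU₀ : ∀ i : Idx P, mlog (exp (b₁ i) * exp (b₂ (τp i)) * exp (b₃ ((1 : Equiv.Perm (Idx P)) (τp i))) *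
      exp (b₄ (τp ((1 : Equiv.Perm (Idx P)) (τp i)))) * (H₀' : Matrix n n ℂ)) =
      mlog ((holAt U₀ (walk (emb Q.src) (stairWord i.2.1 (off i.1))) * rect U₀ (Site.blockSite Q.src i.1) Q.μ Q.ν P.L P.L *
        (holAt U₀ (walk (emb Q.src) (stairWord i.2.1 (off i.1))))⁻¹ : Matrix.specialUnitaryGroup n ℂ) : Matrix n n ℂ) := fun i => by
    rw [hone, hττ, hb₁, hb₂, hb₃, hb₄]
    simp only
    rw [hexpW V₁ τ₀ hτ₀h hgV₁, hexpW V₂ τ₀ hτ₀h hgV₂, hexpW V₃ τ₀ hτ₀h hgV₃, hexpW V₄ τ₀ hτ₀h hgV₄, ← Submonoid.coe_mul, ← Submonoid.coe_mul,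
      ← Submonoid.coe_mul, ← Submonoid.coe_mul]
    have hw : V₁ i * V₂ (τp i) * V₃ (τp i) * V₄ i * H₀' =
        holAt U₀ (walk (emb Q.src) (stairWord i.2.1 (off i.1))) * rect U₀ (Site.blockSite Q.src i.1) Q.μ Q.ν P.L P.L *
          (holAt U₀ (walk (emb Q.src) (stairWord i.2.1 (off i.1))))⁻¹ := by
      rw [hτp]; exact memberWord_eq_conj_rect hj U₀ Q i
    rw [hw]
  -- the relative main term in log currency, BACKGROUND-PRICED (✓p824102), staircase datum `β_A`
  have hLθ : (P.L : ℝ) ^ 2 * θ ≤ 1 / 2 := hL2.trans hτh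
  have hmain := mean_norm_mlog_conjRect_sub_le_bkg hj U U₀ hθ00 hLθ hθ₀θ hU hU₀ Q hS hdev
  have hΔC : ‖((Fintype.card (Idx P) : ℝ))⁻¹ • ∑ i, mlog (exp (a₁ i) * exp (a₂ (τp i)) * exp (a₃ ((1 : Equiv.Perm (Idx P)) (τp i))) *
        exp (a₄ (τp ((1 : Equiv.Perm (Idx P)) (τp i)))) * (H₀ : Matrix n n ℂ)) -
      ((Fintype.card (Idx P) : ℝ))⁻¹ • ∑ i, mlog (exp (b₁ i) * exp (b₂ (τp i)) * exp (b₃ ((1 : Equiv.Perm (Idx P)) (τp i))) *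
        exp (b₄ (τp ((1 : Equiv.Perm (Idx P)) (τp i)))) * (H₀' : Matrix n n ℂ))‖ ≤
      (1 + 2 * ((P.L : ℝ) ^ 2 * θ)) *
        (∑ p : Plaq P j, ((P.L : ℝ) ^ P.d)⁻¹ * (((block Q.src).filter (fun x : Site P j => p.μ = Q.μ ∧ p.ν = Q.ν ∧
            ∃ a ∈ range P.L, ∃ b ∈ range P.L, p.src = shiftN (shiftN x Q.μ a) Q.ν b)).card : ℝ) *
            dist1 ((GaugeField.plaqHol U₀ p)⁻¹ * GaugeField.plaqHol U p) +
          4 * (P.L : ℝ) ^ 3 * θ₀ * γ + 2 * ((P.L : ℝ) ^ 2 * θ₀) * βA) := by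
    rw [← smul_sub, ← Finset.sum_sub_distrib]
    refine (norm_mean_le_mean _ _ fun i => le_rfl).trans ?_
    simp only [hchainU, hchainU₀]
    exact hmain
  -- ### (6) the split `log Ū − log Ū₀ = ΔJ₁₀ − ΔJ₁₄ + Δchain` and the exit
  set Xa := mlog (exp (((Fintype.card (Idx P) : ℝ))⁻¹ • ∑ i, a₁ i) * exp (((Fintype.card (Idx P) : ℝ))⁻¹ • ∑ i, a₂ i) *
      exp (((Fintype.card (Idx P) : ℝ))⁻¹ • ∑ i, a₃ i) * exp (((Fintype.card (Idx P) : ℝ))⁻¹ • ∑ i, a₄ i) * (H₀ : Matrix n n ℂ)) with hXa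
  set Xb := mlog (exp (((Fintype.card (Idx P) : ℝ))⁻¹ • ∑ i, b₁ i) * exp (((Fintype.card (Idx P) : ℝ))⁻¹ • ∑ i, b₂ i) *
      exp (((Fintype.card (Idx P) : ℝ))⁻¹ • ∑ i, b₃ i) * exp (((Fintype.card (Idx P) : ℝ))⁻¹ • ∑ i, b₄ i) * (H₀' : Matrix n n ℂ)) with hXb
  set Na := ((Fintype.card (Idx P) : ℝ))⁻¹ • ∑ i, ((Fintype.card (Idx P) : ℝ))⁻¹ • ∑ j, ((Fintype.card (Idx P) : ℝ))⁻¹ • ∑ k,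
      ((Fintype.card (Idx P) : ℝ))⁻¹ • ∑ l, mlog (exp (a₁ i) * exp (a₂ j) * exp (a₃ k) * exp (a₄ l) * (H₀ : Matrix n n ℂ)) with hNa
  set Nb := ((Fintype.card (Idx P) : ℝ))⁻¹ • ∑ i, ((Fintype.card (Idx P) : ℝ))⁻¹ • ∑ j, ((Fintype.card (Idx P) : ℝ))⁻¹ • ∑ k,
      ((Fintype.card (Idx P) : ℝ))⁻¹ • ∑ l, mlog (exp (b₁ i) * exp (b₂ j) * exp (b₃ k) * exp (b₄ l) * (H₀' : Matrix n n ℂ)) with hNb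
  set Ca := ((Fintype.card (Idx P) : ℝ))⁻¹ • ∑ i, mlog (exp (a₁ i) * exp (a₂ (τp i)) * exp (a₃ ((1 : Equiv.Perm (Idx P)) (τp i))) *
        exp (a₄ (τp ((1 : Equiv.Perm (Idx P)) (τp i)))) * (H₀ : Matrix n n ℂ)) with hCa
  set Cb := ((Fintype.card (Idx P) : ℝ))⁻¹ • ∑ i, mlog (exp (b₁ i) * exp (b₂ (τp i)) * exp (b₃ ((1 : Equiv.Perm (Idx P)) (τp i))) *
        exp (b₄ (τp ((1 : Equiv.Perm (Idx P)) (τp i)))) * (H₀' : Matrix n n ℂ)) with hCb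
  have hsplit : Xa - Xb = ((Xa - Na) - (Xb - Nb)) - ((Ca - Na) - (Cb - Nb)) + (Ca - Cb) := by abel
  have hMM : ‖Xa - Xb‖ ≤ (4096 * (Real.exp (32 * ρ) - 1) * (2 * βm) + 2048 * (Real.exp (32 * ρ) - 1) / ρ * (2 * τ₀) * (4 * βA)) +
      (4096 * ((Real.exp (24 * ρ) - 1) + (Real.exp (16 * ρ) - 1) + (Real.exp (8 * ρ) - 1)) * (2 * βm) +
        2048 * ((Real.exp (24 * ρ) - 1) + (Real.exp (16 * ρ) - 1) + (Real.exp (8 * ρ) - 1)) / ρ * (2 * τ₀) * (4 * βA)) +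
      (1 + 2 * ((P.L : ℝ) ^ 2 * θ)) *
        (∑ p : Plaq P j, ((P.L : ℝ) ^ P.d)⁻¹ * (((block Q.src).filter (fun x : Site P j => p.μ = Q.μ ∧ p.ν = Q.ν ∧
            ∃ a ∈ range P.L, ∃ b ∈ range P.L, p.src = shiftN (shiftN x Q.μ a) Q.ν b)).card : ℝ) *
            dist1 ((GaugeField.plaqHol U₀ p)⁻¹ * GaugeField.plaqHol U p) +
          4 * (P.L : ℝ) ^ 3 * θ₀ * γ + 2 * ((P.L : ℝ) ^ 2 * θ₀) * βA) := by
    rw [hsplit]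
    refine (norm_add_le _ _).trans (add_le_add ((norm_sub_le _ _).trans (add_le_add hJ₁₀ hJ₁₄)) hΔC)
  -- the exit: relative size from relative logarithm (both at the field's `50τ`, since `τ₀ ≤ τ`)
  have hXU : dist1 (GaugeField.plaqHol (avgFun ℰ U) Q) < 1 := hplaqU.trans_lt (by linarith only [hτs])
  have hXU₀ : dist1 (GaugeField.plaqHol (avgFun ℰ U₀) Q) < 1 := hplaqU₀.trans_lt (by linarith only [hτ₀s])
  have hm50U₀ : ‖mlog ((GaugeField.plaqHol (avgFun ℰ U₀) Q : Matrix.specialUnitaryGroup n ℂ) : Matrix n n ℂ)‖ ≤ 50 * τ :=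
    hm50U₀'.trans (by linarith only [hτ₀τ])
  have hexit := dist1_rel_le_mul_norm_mlog_sub (GaugeField.plaqHol (avgFun ℰ U) Q) (GaugeField.plaqHol (avgFun ℰ U₀) Q) hXU hXU₀ hm50U hm50U₀
  rw [hplaqMU, hplaqMU₀] at hexit
  -- ### (7) numerics: `e^{x} − 1 ≤ 2x` on `[0, 1]`
  have hex : ∀ {x : ℝ}, 0 ≤ x → x ≤ 1 → Real.exp x - 1 ≤ 2 * x := fun {x} hx0 hx1 => by
    have h := Real.abs_exp_sub_one_le (x := x) (by rw [abs_of_nonneg hx0]; exact hx1)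
    rw [abs_of_nonneg (by linarith [Real.add_one_le_exp x]), abs_of_nonneg hx0] at h
    exact h
  have E32 : Real.exp (32 * ρ) - 1 ≤ 2 * (32 * ρ) := hex (by linarith only [hρ0']) (by linarith only [hρs])
  have E24 : Real.exp (24 * ρ) - 1 ≤ 2 * (24 * ρ) := hex (by linarith only [hρ0']) (by linarith only [hρs])
  have E16 : Real.exp (16 * ρ) - 1 ≤ 2 * (16 * ρ) := hex (by linarith only [hρ0']) (by linarith only [hρs])
  have E8 : Real.exp (8 * ρ) - 1 ≤ 2 * (8 * ρ) := hex (by linarith only [hρ0']) (by linarith only [hρs])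
  have E50 : Real.exp (50 * τ) ≤ 1 + 100 * τ := by
    have h := hex (x := 50 * τ) (by linarith only [hτ0]) (by linarith only [hτs]); linarith only [h]
  have Q32 : 2048 * (Real.exp (32 * ρ) - 1) / ρ ≤ 2048 * 64 := by
    rw [div_le_iff₀ hρ0]; nlinarith only [E32, hρ0']
  have Q24 : 2048 * ((Real.exp (24 * ρ) - 1) + (Real.exp (16 * ρ) - 1) + (Real.exp (8 * ρ) - 1)) / ρ ≤ 2048 * 96 := by
    rw [div_le_iff₀ hρ0]; nlinarith only [E24, E16, E8, hρ0']
  have hS0 : 0 ≤ ∑ p : Plaq P j, ((P.L : ℝ) ^ P.d)⁻¹ * (((block Q.src).filter (fun x : Site P j => p.μ = Q.μ ∧ p.ν = Q.ν ∧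
      ∃ a ∈ range P.L, ∃ b ∈ range P.L, p.src = shiftN (shiftN x Q.μ a) Q.ν b)).card : ℝ) * dist1 ((GaugeField.plaqHol U₀ p)⁻¹ * GaugeField.plaqHol U p) :=
    Finset.sum_nonneg fun p _ => mul_nonneg (mul_nonneg (inv_nonneg.mpr (pow_nonneg (Nat.cast_nonneg _) _)) (Nat.cast_nonneg _)) (GaugeGroup.dist1_nonneg _)
  have hγ0 : 0 ≤ γ := by
    have h := hdev ⟨emb Q.src, Q.μ⟩ (fun κ => Or.inl (by rw [Site.blockOf_emb hj]))
    exact (GaugeGroup.dist1_nonneg _).trans h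
  generalize hSg : (∑ p : Plaq P j, ((P.L : ℝ) ^ P.d)⁻¹ * (((block Q.src).filter (fun x : Site P j => p.μ = Q.μ ∧ p.ν = Q.ν ∧
      ∃ a ∈ range P.L, ∃ b ∈ range P.L, p.src = shiftN (shiftN x Q.μ a) Q.ν b)).card : ℝ) * dist1 ((GaugeField.plaqHol U₀ p)⁻¹ * GaugeField.plaqHol U p)) = S
    at hMM hS0 ⊢
  have hL0 : (0 : ℝ) ≤ (P.L : ℝ) ^ 3 * θ₀ := by positivity
  have hs00 : 0 ≤ (P.L : ℝ) ^ 2 * θ₀ := by positivity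
  have hτ₀βA0 : 0 ≤ τ₀ * βA := mul_nonneg hτ₀0 hβA0
  have hρβm0 : 0 ≤ ρ * βm := mul_nonneg hρ0' hβm0
  -- ‖Xa − Xb‖ ≤ R₁ := 1310720·ρβm + 2621440·τ₀β_A + (1 + 2τ)(S + 4L³θ₀γ + 2τ₀β_A)
  have hR : ‖Xa - Xb‖ ≤ 1310720 * ρ * βm + 2621440 * τ₀ * βA + (1 + 2 * τ) * (S + 4 * ((P.L : ℝ) ^ 3 * θ₀) * γ + 2 * τ₀ * βA) := by
    have h1a : 4096 * (Real.exp (32 * ρ) - 1) * (2 * βm) ≤ 4096 * (2 * (32 * ρ)) * (2 * βm) :=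
      mul_le_mul_of_nonneg_right (mul_le_mul_of_nonneg_left E32 (by norm_num)) hβm2
    have h1b : 2048 * (Real.exp (32 * ρ) - 1) / ρ * (2 * τ₀) * (4 * βA) ≤ 2048 * 64 * (2 * τ₀) * (4 * βA) :=
      mul_le_mul_of_nonneg_right (mul_le_mul_of_nonneg_right Q32 h2τ₀) (by linarith only [hβA0])
    have h2a : 4096 * ((Real.exp (24 * ρ) - 1) + (Real.exp (16 * ρ) - 1) + (Real.exp (8 * ρ) - 1)) * (2 * βm) ≤ 4096 * (2 * (48 * ρ)) * (2 * βm) :=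
      mul_le_mul_of_nonneg_right (mul_le_mul_of_nonneg_left (by linarith only [E24, E16, E8]) (by norm_num)) hβm2
    have h2b : 2048 * ((Real.exp (24 * ρ) - 1) + (Real.exp (16 * ρ) - 1) + (Real.exp (8 * ρ) - 1)) / ρ * (2 * τ₀) * (4 * βA) ≤
        2048 * 96 * (2 * τ₀) * (4 * βA) :=
      mul_le_mul_of_nonneg_right (mul_le_mul_of_nonneg_right Q24 h2τ₀) (by linarith only [hβA0])
    have h3 : (1 + 2 * ((P.L : ℝ) ^ 2 * θ)) * (S + 4 * (P.L : ℝ) ^ 3 * θ₀ * γ + 2 * ((P.L : ℝ) ^ 2 * θ₀) * βA) ≤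
        (1 + 2 * τ) * (S + 4 * ((P.L : ℝ) ^ 3 * θ₀) * γ + 2 * τ₀ * βA) := by
      have hsβ := mul_le_mul_of_nonneg_right hL2₀ hβA0
      have hin : S + 4 * (P.L : ℝ) ^ 3 * θ₀ * γ + 2 * ((P.L : ℝ) ^ 2 * θ₀) * βA ≤ S + 4 * ((P.L : ℝ) ^ 3 * θ₀) * γ + 2 * τ₀ * βA := by
        linarith only [hsβ]
      have hsβ0 : 0 ≤ (P.L : ℝ) ^ 2 * θ₀ * βA := mul_nonneg hs00 hβA0
      have hLγ0 : 0 ≤ (P.L : ℝ) ^ 3 * θ₀ * γ := mul_nonneg hL0 hγ0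
      have hin0 : 0 ≤ S + 4 * (P.L : ℝ) ^ 3 * θ₀ * γ + 2 * ((P.L : ℝ) ^ 2 * θ₀) * βA := by linarith only [hS0, hsβ0, hLγ0]
      calc (1 + 2 * ((P.L : ℝ) ^ 2 * θ)) * (S + 4 * (P.L : ℝ) ^ 3 * θ₀ * γ + 2 * ((P.L : ℝ) ^ 2 * θ₀) * βA)
          ≤ (1 + 2 * τ) * (S + 4 * (P.L : ℝ) ^ 3 * θ₀ * γ + 2 * ((P.L : ℝ) ^ 2 * θ₀) * βA) := mul_le_mul_of_nonneg_right (by linarith only [hL2]) hin0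
        _ ≤ (1 + 2 * τ) * (S + 4 * ((P.L : ℝ) ^ 3 * θ₀) * γ + 2 * τ₀ * βA) := mul_le_mul_of_nonneg_left hin (by linarith only [hτ0])
    have e : 4096 * (2 * (32 * ρ)) * (2 * βm) + 2048 * 64 * (2 * τ₀) * (4 * βA) + (4096 * (2 * (48 * ρ)) * (2 * βm) + 2048 * 96 * (2 * τ₀) * (4 * βA)) =
        1310720 * ρ * βm + 2621440 * τ₀ * βA := by ring
    linarith only [hMM, h1a, h1b, h2a, h2b, h3, e]
  have hLγ0 : 0 ≤ (P.L : ℝ) ^ 3 * θ₀ * γ := mul_nonneg hL0 hγ0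
  have hB0 : 0 ≤ S + 4 * ((P.L : ℝ) ^ 3 * θ₀) * γ + 2 * τ₀ * βA := by linarith only [hS0, hLγ0, hτ₀βA0]
  -- dist1 ≤ e^{50τ}·‖Xa − Xb‖ ≤ (1 + 100τ)·R₁ ≤ the stated bound
  have hfin : dist1 ((GaugeField.plaqHol (avgFun ℰ U₀) Q)⁻¹ * GaugeField.plaqHol (avgFun ℰ U) Q) ≤
      (1 + 100 * τ) * (1310720 * ρ * βm + 2621440 * τ₀ * βA + (1 + 2 * τ) * (S + 4 * ((P.L : ℝ) ^ 3 * θ₀) * γ + 2 * τ₀ * βA)) :=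
    hexit.trans (mul_le_mul E50 hR (norm_nonneg _) (by linarith only [hτ0]))
  -- the polynomial `ρ·βm` in terms of `τ₀, β_W, β_A`
  have hρle : ρ ≤ 2 * τ₀ + 2 * βW + 5 * βA := by rw [hρdef, hβmdef]; nlinarith only [hτ₀s, hβA0]
  have hρβm : ρ * βm ≤ 2 * τ₀ * βW + 2 * βW ^ 2 + 5 * βW * βA + (1 / 100) * (τ₀ * βA) + 40 * τ₀ * βA ^ 2 := by
    have hρ5 : 0 ≤ 2 * τ₀ + 2 * βW + 5 * βA := by linarith only [hτ₀0, hβW0, hβA0]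
    have h1 : ρ * βW ≤ (2 * τ₀ + 2 * βW + 5 * βA) * βW := mul_le_mul_of_nonneg_right hρle hβW0
    have h2 : ρ * (8 * τ₀ * βA) ≤ (2 * τ₀ + 2 * βW + 5 * βA) * (8 * τ₀ * βA) := mul_le_mul_of_nonneg_right hρle (by linarith only [hτ₀βA0])
    have h3 : (16 * τ₀ + 16 * βW) * (τ₀ * βA) ≤ (1 / 100) * (τ₀ * βA) := mul_le_mul_of_nonneg_right (by linarith only [hτ₀s, hβWs]) hτ₀βA0
    have e : ρ * βm = ρ * βW + ρ * (8 * τ₀ * βA) := by rw [hβmdef]; ring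
    nlinarith only [h1, h2, h3, e]
  have hc1 : (1 + 100 * τ) * (1 + 2 * τ) ≤ 1 + 104 * τ := by nlinarith only [hτs, hτ0]
  have hc104 : 1 + 104 * τ ≤ 1 + 1 / 30 := by linarith only [hτs]
  have hc100 : 1 + 100 * τ ≤ 1 + 1 / 32 := by linarith only [hτs]
  have h100 : 0 ≤ 1 + 100 * τ := by linarith only [hτ0]
  have step : (1 + 100 * τ) * (1310720 * ρ * βm + 2621440 * τ₀ * βA + (1 + 2 * τ) * (S + 4 * ((P.L : ℝ) ^ 3 * θ₀) * γ + 2 * τ₀ * βA)) ≤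
      (1 + 104 * τ) * S + 2800000 * τ₀ * (βW + βA) + 2800000 * βW ^ 2 + 7000000 * βW * βA + 56000000 * τ₀ * βA ^ 2 + 5 * ((P.L : ℝ) ^ 3 * θ₀) * γ := by
    have e1 : (1 + 100 * τ) * ((1 + 2 * τ) * (S + 4 * ((P.L : ℝ) ^ 3 * θ₀) * γ + 2 * τ₀ * βA)) ≤
        (1 + 104 * τ) * (S + 4 * ((P.L : ℝ) ^ 3 * θ₀) * γ + 2 * τ₀ * βA) := by
      rw [← mul_assoc]; exact mul_le_mul_of_nonneg_right hc1 hB0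
    have e2 : (1 + 104 * τ) * (4 * ((P.L : ℝ) ^ 3 * θ₀) * γ) ≤ 5 * ((P.L : ℝ) ^ 3 * θ₀) * γ := by nlinarith only [hc104, hLγ0]
    have e3 : (1 + 104 * τ) * (2 * τ₀ * βA) ≤ 3 * (τ₀ * βA) := by nlinarith only [hc104, hτ₀βA0]
    have e4 : (1 + 100 * τ) * (1310720 * ρ * βm) ≤ (1 + 1 / 32) * 1310720 * (2 * τ₀ * βW + 2 * βW ^ 2 + 5 * βW * βA + (1 / 100) * (τ₀ * βA) + 40 * τ₀ * βA ^ 2) := by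
      have h := mul_le_mul hc100 (mul_le_mul_of_nonneg_left hρβm (by norm_num : (0 : ℝ) ≤ 1310720)) (by positivity) (by norm_num)
      calc (1 + 100 * τ) * (1310720 * ρ * βm) = (1 + 100 * τ) * (1310720 * (ρ * βm)) := by ring
        _ ≤ (1 + 1 / 32) * (1310720 * (2 * τ₀ * βW + 2 * βW ^ 2 + 5 * βW * βA + (1 / 100) * (τ₀ * βA) + 40 * τ₀ * βA ^ 2)) := h
        _ = (1 + 1 / 32) * 1310720 * (2 * τ₀ * βW + 2 * βW ^ 2 + 5 * βW * βA + (1 / 100) * (τ₀ * βA) + 40 * τ₀ * βA ^ 2) := by ring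
    have e5 : (1 + 100 * τ) * (2621440 * τ₀ * βA) ≤ (1 + 1 / 32) * 2621440 * (τ₀ * βA) := by nlinarith only [hc100, hτ₀βA0]
    have hβW2 : 0 ≤ βW ^ 2 := sq_nonneg _
    have hβWA : 0 ≤ βW * βA := mul_nonneg hβW0 hβA0
    have hτβW : 0 ≤ τ₀ * βW := mul_nonneg hτ₀0 hβW0
    have hτβA2 : 0 ≤ τ₀ * βA ^ 2 := mul_nonneg hτ₀0 (sq_nonneg _)
    nlinarith only [e1, e2, e3, e4, e5, hS0, hβW2, hβWA, hτβW, hτβA2, hτ₀βA0, hLγ0, h100]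
  have h4 : 1 + 26 * (4 * τ) = 1 + 104 * τ := by ring
  have h5 : 700000 * (4 * τ₀) * (βW + βA) = 2800000 * τ₀ * (βW + βA) := by ring
  have h6 : 14000000 * (4 * τ₀) * βA ^ 2 = 56000000 * τ₀ * βA ^ 2 := by ring
  rw [h4τ, h4τ₀, h4, h5, h6]
  calc dist1 ((GaugeField.plaqHol (avgFun ℰ U₀) Q)⁻¹ * GaugeField.plaqHol (avgFun ℰ U) Q) ≤ _ := hfin
    _ ≤ _ := step
    _ = (1 + 104 * τ) * S + 2800000 * τ₀ * (βW + βA) + 2800000 * βW ^ 2 + 7000000 * βW * βA + 56000000 * τ₀ * βA ^ 2 + 5 * (P.L : ℝ) ^ 3 * θ₀ * γ := by ring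

end Summit.QuantumFields.YangMills.Theorems.FluctuationComparisonRegPrIntLS2BetaRelativeOneLevelStepArc

end
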